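import Mathlib.Analysis.Fourier.LpSpace
import Mathlib.Analysis.Distribution.AEEqOfIntegralContDiff
import Mathlib.Analysis.MellinInversion
import Mathlib.MeasureTheory.Function.L2Space
import HarnessLib

/-!
# Plancherel's theorem for `L¹ ∩ L²` functions and the Mellin–Plancherel identity

Trunk T-SOBOLEV (Analysis/FunctionSpaces); used by T-ANT (the Nyman–Beurling–Báez-Duarte
criterion, `Literature/NumberTheory/LFunctions/NymanBeurling*.lean`).

Mathlib has the Fourier transform on `L²(V)` (`V` a finite-dimensional real inner product space)
as a linear isometry equivalence `MeasureTheory.Lp.fourierTransformₗᵢ` obtained by extending the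
Schwartz-space Fourier transform (`Mathlib/Analysis/Fourier/LpSpace.lean`), and the Fourier
*integral* `𝓕 f` of an integrable function (`Mathlib/Analysis/Fourier/FourierTransform.lean`), but
not (yet) the statement that the two agree on `L¹ ∩ L²`. This file proves it, and deduces the
classical Plancherel identity for `f ∈ L¹ ∩ L²` and its multiplicative version on `(0,∞)`
(the "Mellin–Plancherel" or "Parseval formula for Mellin transforms").

## Main results (all proved)

* `Literature.Analysis.FunctionSpaces.fourier_toLp_ae_eq_fourierIntegral` : for `f ∈ L¹ ∩ L²(V; F)`, the `L²`-Fourier transform of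
  the class of `f` is a.e. equal to the Fourier integral `𝓕 f`.
* `Literature.Analysis.FunctionSpaces.memLp_two_fourierIntegral`, `Literature.Analysis.FunctionSpaces.eLpNorm_fourierIntegral_eq`,
  `Literature.Analysis.FunctionSpaces.lintegral_enorm_sq_fourierIntegral_eq`, `Literature.Analysis.FunctionSpaces.integral_norm_sq_fourierIntegral_eq` :
  Plancherel's theorem `‖𝓕 f‖_{L²} = ‖f‖_{L²}` for `f ∈ L¹ ∩ L²` (Titchmarsh, *Fourier Integrals*,
  Thm. 48; Rudin, *Real and Complex Analysis*, Thm. 9.13 (b)).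
* `Literature.Analysis.FunctionSpaces.integral_norm_sq_mellin_eq` : for `f : (0,∞) → F` with `∫_0^∞ ‖f(x)‖ x^{σ-1} dx < ∞` and
  `∫_0^∞ ‖f(x)‖² x^{2σ-1} dx < ∞`,
  `∫_{-∞}^{∞} ‖(𝓜f)(σ + iτ)‖² dτ = 2π ∫_0^∞ ‖f(x)‖² x^{2σ-1} dx`
  (Titchmarsh, *Fourier Integrals*, Thm. 71 / eq. (2.1.19) with `f = g`), via Mathlib's
  `mellin_eq_fourier` (the substitution `x = e^{-u}`).

## References

* E. C. Titchmarsh, *Introduction to the Theory of Fourier Integrals*, 2nd ed., Oxford 1948,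
  Thm. 48 (Plancherel), §3.17 Thm. 71 (Parseval for Mellin transforms).
* W. Rudin, *Real and Complex Analysis*, 3rd ed., McGraw–Hill 1987, Thm. 9.13.
-/

noncomputable section

open MeasureTheory SchwartzMap FourierTransform Complex Set Filter
open scoped ENNReal Topology Real

namespace Literature.Analysis.FunctionSpaces

section Fourier

variable {V : Type*} [NormedAddCommGroup V] [InnerProductSpace ℝ V] [FiniteDimensional ℝ V]
  [MeasurableSpace V] [BorelSpace V]
variable {F : Type*} [NormedAddCommGroup F] [InnerProductSpace ℂ F] [CompleteSpace F]

omit [CompleteSpace F] in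
/-- The Fourier integral of an integrable function is continuous (Mathlib's
`VectorFourier.fourierIntegral_continuous`, specialised to `Real.fourierIntegral`). [folklore] -/
lemma continuous_fourierIntegral {f : V → F} (hf : Integrable f) : Continuous (𝓕 f) :=
  VectorFourier.fourierIntegral_continuous Real.continuous_fourierChar
    (innerSL ℝ).continuous₂ hf

/-- Self-adjointness of the Fourier integral against a Schwartz function:
`∫ 𝓕ψ • f = ∫ ψ • 𝓕f` for `f ∈ L¹`. [folklore] -/
lemma integral_fourier_schwartz_smul_eq (ψ : 𝓢(V, ℂ)) {f : V → F} (hf : Integrable f) :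
    ∫ ξ, 𝓕 (ψ : V → ℂ) ξ • f ξ = ∫ x, ψ x • 𝓕 f x := by
  have h := VectorFourier.integral_fourierIntegral_smul_eq_flip (L := innerₗ V) (μ := volume)
    (ν := volume) Real.continuous_fourierChar continuous_inner ψ.integrable hf
  rw [flip_innerₗ] at h
  exact h

/-- **The `L²`-Fourier transform agrees with the Fourier integral on `L¹ ∩ L²`.** For
`f ∈ L¹(V) ∩ L²(V)`, Mathlib's `L²` Fourier transform (the extension by continuity of the
Schwartz Fourier transform) of the class of `f` is represented by the Fourier integral
`𝓕 f(ξ) = ∫ e^{-2πi⟨v,ξ⟩} f(v) dv`. Proof: both define the same tempered distribution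
(`Lp.fourier_toTemperedDistribution_eq` and self-adjointness of the Fourier integral against Schwartz
functions), and two locally integrable functions with the same integrals against smooth compactly
supported functions agree a.e. [folklore] -/
theorem fourier_toLp_ae_eq_fourierIntegral {f : V → F} (h1 : Integrable f) (h2 : MemLp f 2) :
    ((𝓕 (h2.toLp f) : Lp F 2 (volume : Measure V)) : V → F) =ᵐ[volume] 𝓕 f := by
  set T : Lp F 2 (volume : Measure V) := 𝓕 (h2.toLp f) with hT_def
  have hT : LocallyIntegrable (T : V → F) := (Lp.memLp T).locallyIntegrable (by norm_num)
  have hFf : LocallyIntegrable (𝓕 f) := (continuous_fourierIntegral h1).locallyIntegrable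
  refine ae_eq_of_integral_contDiff_smul_eq hT hFf fun g hg_smooth hg_supp ↦ ?_
  -- the complexified test function, as a Schwartz map
  have hgc_smooth : ContDiff ℝ (⊤ : ℕ∞) fun x ↦ (g x : ℂ) := ofRealCLM.contDiff.comp hg_smooth
  have hgc_supp : HasCompactSupport fun x ↦ (g x : ℂ) := hg_supp.comp_left ofReal_zero
  set ψ : 𝓢(V, ℂ) := hgc_supp.toSchwartzMap hgc_smooth with hψ_def
  have hψ : ∀ x, ψ x = (g x : ℂ) := fun x ↦ rfl
  have hsmul : ∀ (x : V) (y : F), g x • y = ψ x • y := fun x y ↦ by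
    rw [hψ, Complex.coe_smul]
  calc ∫ x, g x • (T : V → F) x
      = ∫ x, ψ x • (T : V → F) x := by simp_rw [hsmul]
    _ = (T : 𝓢'(V, F)) ψ := (Lp.toTemperedDistribution_apply T ψ).symm
    _ = (𝓕 ((h2.toLp f : Lp F 2 (volume : Measure V)) : 𝓢'(V, F))) ψ := by
        rw [hT_def, Lp.fourier_toTemperedDistribution_eq]
    _ = ((h2.toLp f : Lp F 2 (volume : Measure V)) : 𝓢'(V, F)) (𝓕 ψ) :=
        TemperedDistribution.fourier_apply _ _
    _ = ∫ x, (𝓕 ψ) x • (h2.toLp f : V → F) x := Lp.toTemperedDistribution_apply _ _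
    _ = ∫ x, 𝓕 (ψ : V → ℂ) x • f x := by
        refine integral_congr_ae ?_
        filter_upwards [h2.coeFn_toLp] with x hx
        rw [hx, SchwartzMap.fourier_coe]
    _ = ∫ x, ψ x • 𝓕 f x := integral_fourier_schwartz_smul_eq ψ h1
    _ = ∫ x, g x • 𝓕 f x := by simp_rw [hsmul]

/-- **Plancherel for `L¹ ∩ L²`, membership**: the Fourier integral of `f ∈ L¹ ∩ L²` is in `L²`
(Titchmarsh, *Fourier Integrals*, Thm. 48). [folklore] -/
theorem memLp_two_fourierIntegral {f : V → F} (h1 : Integrable f) (h2 : MemLp f 2) :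
    MemLp (𝓕 f) 2 (volume : Measure V) :=
  (Lp.memLp _).ae_eq (fourier_toLp_ae_eq_fourierIntegral h1 h2)

/-- **Plancherel's theorem for `L¹ ∩ L²`** (`eLpNorm` form): `‖𝓕 f‖_{L²} = ‖f‖_{L²}` for
`f ∈ L¹(V) ∩ L²(V)` (Titchmarsh, *Fourier Integrals*, Thm. 48; Rudin, *Real and Complex Analysis*,
Thm. 9.13). From Mathlib's `Lp.norm_fourier_eq` and `fourier_toLp_ae_eq_fourierIntegral`. [folklore] -/
theorem eLpNorm_fourierIntegral_eq {f : V → F} (h1 : Integrable f) (h2 : MemLp f 2) :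
    eLpNorm (𝓕 f) 2 (volume : Measure V) = eLpNorm f 2 volume := by
  rw [← eLpNorm_congr_ae (fourier_toLp_ae_eq_fourierIntegral h1 h2), ← Lp.enorm_def,
    eLpNorm_congr_ae h2.coeFn_toLp.symm, ← Lp.enorm_def, ← ofReal_norm, ← ofReal_norm,
    Lp.norm_fourier_eq]

/-- **Plancherel's theorem for `L¹ ∩ L²`** (`∫⁻` form): `∫ ‖𝓕 f‖ₑ² = ∫ ‖f‖ₑ²`. [folklore] -/
theorem lintegral_enorm_sq_fourierIntegral_eq {f : V → F} (h1 : Integrable f) (h2 : MemLp f 2) :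
    ∫⁻ ξ, ‖𝓕 f ξ‖ₑ ^ 2 = ∫⁻ x, ‖f x‖ₑ ^ 2 := by
  have h := eLpNorm_fourierIntegral_eq h1 h2
  rw [eLpNorm_eq_lintegral_rpow_enorm_toReal two_ne_zero ENNReal.ofNat_ne_top,
    eLpNorm_eq_lintegral_rpow_enorm_toReal two_ne_zero ENNReal.ofNat_ne_top] at h
  simp only [ENNReal.toReal_ofNat, one_div] at h
  have h' := congrArg (fun x : ℝ≥0∞ ↦ x ^ (2 : ℝ)) h
  simp only [← ENNReal.rpow_mul, show (2 : ℝ)⁻¹ * 2 = 1 by norm_num, ENNReal.rpow_one] at h'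
  simpa [ENNReal.rpow_two] using h'

/-- **Plancherel's theorem for `L¹ ∩ L²`** (Bochner-integral form): `∫ ‖𝓕 f ξ‖² dξ = ∫ ‖f x‖² dx`
for `f ∈ L¹(V) ∩ L²(V)` (Titchmarsh, *Fourier Integrals*, Thm. 48). [folklore] -/
theorem integral_norm_sq_fourierIntegral_eq {f : V → F} (h1 : Integrable f) (h2 : MemLp f 2) :
    ∫ ξ, ‖𝓕 f ξ‖ ^ 2 = ∫ x, ‖f x‖ ^ 2 := by
  have hF := memLp_two_fourierIntegral h1 h2
  have i1 : Integrable (fun ξ ↦ ‖𝓕 f ξ‖ ^ 2) (volume : Measure V) :=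
    (memLp_two_iff_integrable_sq_norm hF.1).1 hF
  have i2 : Integrable (fun x ↦ ‖f x‖ ^ 2) (volume : Measure V) :=
    (memLp_two_iff_integrable_sq_norm h2.1).1 h2
  rw [integral_eq_lintegral_of_nonneg_ae (Eventually.of_forall fun _ ↦ by positivity)
      i1.aestronglyMeasurable,
    integral_eq_lintegral_of_nonneg_ae (Eventually.of_forall fun _ ↦ by positivity)
      i2.aestronglyMeasurable]
  congr 1
  have e1 : ∀ (g : V → F) (x : V), ENNReal.ofReal (‖g x‖ ^ 2) = ‖g x‖ₑ ^ 2 := fun g x ↦ by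
    rw [← ofReal_norm, ENNReal.ofReal_pow (norm_nonneg _)]
  simp_rw [e1]
  exact lintegral_enorm_sq_fourierIntegral_eq h1 h2

end Fourier

section Mellin

/-! ### The Mellin–Plancherel identity on `(0,∞)` -/

variable {F : Type*} [NormedAddCommGroup F] [InnerProductSpace ℂ F] [CompleteSpace F]

/-- Derivative of `u ↦ e^{-u}` (Mathlib's `rexp_neg_deriv_aux` in `MellinInversion.lean` is
private). [folklore] -/
lemma hasDerivWithinAt_exp_neg :
    ∀ x ∈ (univ : Set ℝ), HasDerivWithinAt (rexp ∘ Neg.neg) (-rexp (-x)) univ x :=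
  fun x _ ↦ mul_neg_one (rexp (-x)) ▸
    ((Real.hasDerivAt_exp (-x)).comp x (hasDerivAt_neg x)).hasDerivWithinAt

/-- `u ↦ e^{-u}` maps `ℝ` onto `(0,∞)`. [folklore] -/
lemma image_exp_neg_univ : rexp ∘ Neg.neg '' univ = Ioi 0 := by
  rw [Set.image_comp, Set.image_univ_of_surjective neg_surjective, Set.image_univ, Real.range_exp]

/-- `u ↦ e^{-u}` is injective. [folklore] -/
lemma injOn_exp_neg : univ.InjOn (rexp ∘ Neg.neg) :=
  Real.exp_injective.injOn.comp neg_injective.injOn (univ.mapsTo_univ _)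

/-- The substitution `t = e^{-u}`, integrability form:
`φ ∈ L¹(0,∞) ↔ (u ↦ e^{-u} φ(e^{-u})) ∈ L¹(ℝ)`. [folklore] -/
lemma integrableOn_Ioi_iff_integrable_exp_neg_smul {E : Type*} [NormedAddCommGroup E]
    [NormedSpace ℝ E] (φ : ℝ → E) :
    IntegrableOn φ (Ioi 0) ↔ Integrable fun u : ℝ ↦ rexp (-u) • φ (rexp (-u)) := by
  rw [← image_exp_neg_univ, integrableOn_image_iff_integrableOn_abs_deriv_smul MeasurableSet.univ
    hasDerivWithinAt_exp_neg injOn_exp_neg, integrableOn_univ]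
  simp [abs_of_pos (Real.exp_pos _)]

/-- The substitution `t = e^{-u}`: `∫_0^∞ φ(t) dt = ∫_{-∞}^{∞} e^{-u} φ(e^{-u}) du`. [folklore] -/
lemma integral_Ioi_eq_integral_exp_neg_smul {E : Type*} [NormedAddCommGroup E] [NormedSpace ℝ E]
    (φ : ℝ → E) : ∫ t in Ioi 0, φ t = ∫ u : ℝ, rexp (-u) • φ (rexp (-u)) := by
  rw [← image_exp_neg_univ, integral_image_eq_integral_abs_deriv_smul MeasurableSet.univ
    hasDerivWithinAt_exp_neg injOn_exp_neg, Measure.restrict_univ]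
  simp [abs_of_pos (Real.exp_pos _)]

/-- The pointwise identity `e^{-u} · (e^{-u})^{a-1} = e^{-a u}` behind the substitution
`t = e^{-u}` in Mellin integrals. [folklore] -/
lemma exp_neg_mul_exp_neg_rpow (a u : ℝ) : rexp (-u) * rexp (-u) ^ (a - 1) = rexp (-a * u) := by
  rw [← Real.exp_mul, ← Real.exp_add]
  congr 1
  ring

/-- **Mellin–Plancherel (Parseval's formula for Mellin transforms).** Let `f : (0,∞) → F` with
`∫_0^∞ ‖f(x)‖ x^{σ-1} dx < ∞` (so that the Mellin transform `𝓜f(s) = ∫_0^∞ f(x) x^{s-1} dx`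
converges absolutely on `re s = σ`) and `∫_0^∞ ‖f(x)‖² x^{2σ-1} dx < ∞`. Then
`τ ↦ ‖𝓜f(σ+iτ)‖²` is integrable and
`∫_{-∞}^{∞} ‖𝓜f(σ + iτ)‖² dτ = 2π ∫_0^∞ ‖f(x)‖² x^{2σ-1} dx`
(Titchmarsh, *Fourier Integrals*, Thm. 71, eq. (2.1.19) with `g = f̄`; for `σ = 1/2` this is the
statement that `f ↦ (2π)^{-1/2} 𝓜f(1/2 + i·)` is an isometry `L²(0,∞) → L²(-∞,∞)` on
`L¹(x^{-1/2}dx) ∩ L²`). Proof: `𝓜f(σ+iτ) = 𝓕G(τ/2π)` with `G(u) = e^{-σu} f(e^{-u})`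
(Mathlib `mellin_eq_fourier`), `G ∈ L¹ ∩ L²(ℝ)`, and Plancherel for `L¹ ∩ L²`. [folklore] -/
theorem integral_norm_sq_mellin_eq {f : ℝ → F} {σ : ℝ} (hf : MellinConvergent f σ)
    (hf2 : IntegrableOn (fun x : ℝ ↦ ‖f x‖ ^ 2 * x ^ (2 * σ - 1)) (Ioi 0)) :
    Integrable (fun τ : ℝ ↦ ‖mellin f (σ + τ * I)‖ ^ 2) ∧
      ∫ τ : ℝ, ‖mellin f (σ + τ * I)‖ ^ 2 =
        2 * π * ∫ x in Ioi 0, ‖f x‖ ^ 2 * x ^ (2 * σ - 1) := by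
  set G : ℝ → F := fun u ↦ rexp (-σ * u) • f (rexp (-u)) with hG
  have hmel : ∀ τ : ℝ, mellin f (σ + τ * I) = 𝓕 G (τ / (2 * π)) := by
    intro τ
    rw [mellin_eq_fourier]
    simp [hG]
  -- `G ∈ L¹`
  have hG1 : Integrable G := by
    have h := (integrableOn_Ioi_iff_integrable_exp_neg_smul _).1 hf
    refine h.congr (Eventually.of_forall fun u ↦ ?_)
    have hpos : 0 < rexp (-u) := Real.exp_pos _
    simp only [hG]
    rw [show (σ : ℂ) - 1 = ((σ - 1 : ℝ) : ℂ) by push_cast; ring, ← ofReal_cpow hpos.le,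
      Complex.coe_smul, smul_smul, exp_neg_mul_exp_neg_rpow]
  -- `‖G‖² ∈ L¹`, and its integral
  have hnormsq : ∀ u : ℝ, rexp (-u) • (‖f (rexp (-u))‖ ^ 2 * rexp (-u) ^ (2 * σ - 1)) =
      ‖G u‖ ^ 2 := by
    intro u
    simp only [hG, norm_smul, Real.norm_eq_abs, abs_of_pos (Real.exp_pos _), smul_eq_mul]
    rw [mul_pow, ← Real.exp_mul]
    have h : rexp (-u) * rexp (-u * (2 * σ - 1)) = rexp (-σ * u) ^ 2 := by
      rw [sq, ← Real.exp_add, ← Real.exp_add]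
      congr 1
      ring
    rw [← h]
    ring
  have hG2i : Integrable fun u ↦ ‖G u‖ ^ 2 := by
    have h := (integrableOn_Ioi_iff_integrable_exp_neg_smul _).1 hf2
    exact h.congr (Eventually.of_forall hnormsq)
  have hG2 : MemLp G 2 := (memLp_two_iff_integrable_sq_norm hG1.aestronglyMeasurable).2 hG2i
  have hint : ∫ u, ‖G u‖ ^ 2 = ∫ x in Ioi 0, ‖f x‖ ^ 2 * x ^ (2 * σ - 1) := by
    rw [integral_Ioi_eq_integral_exp_neg_smul]
    exact integral_congr_ae (Eventually.of_forall fun u ↦ (hnormsq u).symm)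
  -- Plancherel for `G`
  have hP := integral_norm_sq_fourierIntegral_eq hG1 hG2
  have hPi : Integrable (fun ξ : ℝ ↦ ‖𝓕 G ξ‖ ^ 2) := by
    have hF := memLp_two_fourierIntegral hG1 hG2
    exact (memLp_two_iff_integrable_sq_norm hF.1).1 hF
  have h2π : (2 * π : ℝ) ≠ 0 := by positivity
  refine ⟨?_, ?_⟩
  · simp_rw [hmel]
    exact hPi.comp_div h2π
  · simp_rw [hmel]
    rw [Measure.integral_comp_div (fun ξ ↦ ‖𝓕 G ξ‖ ^ 2) (2 * π), hP, hint, smul_eq_mul,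
      abs_of_pos (by positivity : (0 : ℝ) < 2 * π)]

/-- **Mellin–Plancherel on the critical line** (`σ = 1/2`): if `∫_0^∞ ‖f(x)‖ x^{-1/2} dx < ∞` and
`f ∈ L²(0,∞)` then `∫_{-∞}^{∞} ‖𝓜f(1/2 + iτ)‖² dτ = 2π ∫_0^∞ ‖f(x)‖² dx`
(Titchmarsh, *Fourier Integrals*, Thm. 71; the "invertible isometry `𝓗 → 𝓚`" of Báez-Duarte 2003,
§2.2, restricted to functions with absolutely convergent Mellin transform). [folklore] -/
theorem integral_norm_sq_mellin_half_eq {f : ℝ → F} (hf : MellinConvergent f (1 / 2 : ℂ))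
    (hf2 : IntegrableOn (fun x : ℝ ↦ ‖f x‖ ^ 2) (Ioi 0)) :
    Integrable (fun τ : ℝ ↦ ‖mellin f (1 / 2 + τ * I)‖ ^ 2) ∧
      ∫ τ : ℝ, ‖mellin f (1 / 2 + τ * I)‖ ^ 2 = 2 * π * ∫ x in Ioi 0, ‖f x‖ ^ 2 := by
  have hf' : MellinConvergent f ((1 / 2 : ℝ) : ℂ) := by
    convert hf using 2; push_cast; ring
  have hf2' : IntegrableOn (fun x : ℝ ↦ ‖f x‖ ^ 2 * x ^ (2 * (1 / 2 : ℝ) - 1)) (Ioi 0) := by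
    refine hf2.congr_fun (fun x _ ↦ ?_) measurableSet_Ioi
    norm_num
  obtain ⟨h1, h2⟩ := integral_norm_sq_mellin_eq hf' hf2'
  have e : ∀ τ : ℝ, ((1 / 2 : ℝ) : ℂ) + τ * I = 1 / 2 + τ * I := fun τ ↦ by push_cast; ring
  simp_rw [e] at h1 h2
  refine ⟨h1, ?_⟩
  rw [h2]
  congr 1
  refine setIntegral_congr_fun measurableSet_Ioi fun x _ ↦ ?_
  norm_num

end Mellin

end Literature.Analysis.FunctionSpaces
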